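import Summits.HodgeConjecture.HodgeCM.Model.ConjTwist_1

/-! PORT of `HodgeCM/Model/ConjTwist.lean` (HodgeCMPerL run 82) — part 2: continuation of `Summits.HodgeConjecture.HodgeCM.Model.ConjTwist_1` (split at a top-level declaration boundary by port_pkg.py; scope re-opened below; declarations unchanged). -/

-- port_pkg: scope re-opened for this part (file-level context, then the namespace/section stack open at the cut)
noncomputable section
open scoped TensorProduct
namespace HodgeCM
open Literature.AlgebraicGeometry.Motives (CMType HodgeStructure)
open Literature.AlgebraicGeometry.Motives.HodgeStructure (conj ofRat complexConj conj_conj conj_ofRat mem_complexConj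
  complexConj_complexConj complexConj_top complexConj_bot complexConj_mono complexConj_inf conj_baseChange)
namespace Universe
variable {U : Universe} {D : ℕ → Bool}
namespace ConjTwist
set_option smartUnfolding false in
/-- (Ported verbatim from the HodgeCMPerL package; no docstring in the source.) -/
theorem realisationExistsPerL (h : U.RealisationExistsPerL) : (U.conjTwist D).RealisationExistsPerL := by
  intro K L j hN hK hL φ hφ ι₁ hι t ht V
  obtain ⟨r⟩ := h K L j hN hK hL φ hφ ι₁ hι t ht V
  exact ⟨{ r with }⟩

/-! ### N2 fails -/

set_option smartUnfolding false in
/-- **The mechanism.**  If `H³` is twisted, then N2 for `U.conjTwist D` together with N2 and N4 for `U` forces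
`H²(X, ℂ) ∪ H¹(X, ℂ) = 0`: for `y ∈ F¹H¹` split `x = x₁ + x₂ ∈ F¹H² ⊕ conj F²H²`; then `x₁ ∪ y ∈ F²H³` (N2) and
`conj (x₁ ∪ y) ∈ F²H³` (twisted N2), and `conj (x₂ ∪ y) = conj x₂ ∪ conj y ∈ F² ∪ F⁰ ⊆ F²H³` (N2, N4) with
`x₂ ∪ y ∈ F²H³` (twisted N2); but `F²H³ ∩ conj F²H³ = 0` in weight `3`.  A general `y` splits along `H¹_ℂ = F¹ ⊕ conj F¹`. -/
theorem cupC_two_one_eq_zero (hD3 : degTwist D 3 = true) (h2 : U.Fact_cup_hodge) (h4 : U.Fact_hodge_F0)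
    (h : (U.conjTwist D).Fact_cup_hodge) (X : U.Var) (x : U.CohC X 2) (y : U.CohC X 1) : U.cupC X 2 1 x y = 0 := by
  -- twisted N2 in degrees (2, 1): the target filtration is `conj F H³`
  have hN2' : ∀ (p q : ℤ) (x : U.CohC X 2) (y : U.CohC X 1), x ∈ (U.hodge X 2).F p → y ∈ (U.hodge X 1).F q →
      conj (U.cupC X 2 1 x y) ∈ (U.hodge X 3).F (p + q) := by
    intro p q x y hx hy
    have h' := h X 2 1 p q x y hx hy
    change U.cupC X 2 1 x y ∈ (U.twistHodge D X 3).F (p + q) at h'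
    rw [twistHodge_of_true hD3] at h'
    exact h'
  -- weight 3: `F² ∩ conj F² = 0`
  have hbot : ∀ z : U.CohC X 3, z ∈ (U.hodge X 3).F 2 → conj z ∈ (U.hodge X 3).F 2 → z = 0 := by
    intro z hz hz'
    have hc := ((U.hodge X 3).isCompl_F_complexConj 2 2 (by norm_num)).inf_eq_bot
    have hmem : z ∈ (U.hodge X 3).F 2 ⊓ complexConj ((U.hodge X 3).F 2) := ⟨hz, hz'⟩
    rw [hc] at hmem
    exact (Submodule.mem_bot ℂ).mp hmem
  -- N4: `F⁰ H¹ = ⊤`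
  have hF0 : ∀ w : U.CohC X 1, w ∈ (U.hodge X 1).F 0 := fun w => by
    rw [h4 X 1]
    exact Submodule.mem_top
  -- Step 1: `y ∈ F¹ H¹`
  have key : ∀ (x : U.CohC X 2) (y : U.CohC X 1), y ∈ (U.hodge X 1).F 1 → U.cupC X 2 1 x y = 0 := by
    intro x y hy
    have hsum : x ∈ (U.hodge X 2).F 1 ⊔ complexConj ((U.hodge X 2).F 2) := by
      rw [((U.hodge X 2).isCompl_F_complexConj 1 2 (by norm_num)).sup_eq_top]
      exact Submodule.mem_top
    obtain ⟨x₁, hx₁, x₂, hx₂, rfl⟩ := Submodule.mem_sup.mp hsum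
    rw [map_add, LinearMap.add_apply]
    have e1 : U.cupC X 2 1 x₁ y = 0 := by
      refine hbot _ ?_ ?_
      · have := h2 X 2 1 1 1 x₁ y hx₁ hy
        norm_num at this
        exact this
      · have := hN2' 1 1 x₁ y hx₁ hy
        norm_num at this
        exact this
    have e2 : U.cupC X 2 1 x₂ y = 0 := by
      have hw : conj (U.cupC X 2 1 x₂ y) = 0 := by
        refine hbot _ ?_ ?_
        · rw [conj_cupC]
          have := h2 X 2 1 2 0 (conj x₂) (conj y) hx₂ (hF0 _)
          norm_num at this
          exact this
        · rw [conj_cupC]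
          have := hN2' 2 0 (conj x₂) (conj y) hx₂ (hF0 _)
          norm_num at this
          exact this
      rw [← conj_conj (U.cupC X 2 1 x₂ y), hw, map_zero]
    rw [e1, e2, add_zero]
  -- Step 2: general `y`
  have hsum : y ∈ (U.hodge X 1).F 1 ⊔ complexConj ((U.hodge X 1).F 1) := by
    rw [((U.hodge X 1).isCompl_F_complexConj 1 1 (by norm_num)).sup_eq_top]
    exact Submodule.mem_top
  obtain ⟨y₁, hy₁, y₂, hy₂, rfl⟩ := Submodule.mem_sup.mp hsum
  rw [map_add, key x y₁ hy₁, zero_add]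
  have hw : conj (U.cupC X 2 1 x y₂) = 0 := by
    rw [conj_cupC]
    exact key (conj x) (conj y₂) hy₂
  rw [← conj_conj (U.cupC X 2 1 x y₂), hw, map_zero]

set_option smartUnfolding false in
/-- Rational version: `H²(X, ℚ) ∪ H¹(X, ℚ) = 0`. -/
theorem cup_two_one_eq_zero (hD3 : degTwist D 3 = true) (h2 : U.Fact_cup_hodge) (h4 : U.Fact_hodge_F0)
    (h : (U.conjTwist D).Fact_cup_hodge) (X : U.Var) (x : U.Coh X 2) (y : U.Coh X 1) : U.cup X 2 1 x y = 0 := by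
  have h0 := cupC_two_one_eq_zero hD3 h2 h4 h X (ofRat x) (ofRat y)
  rw [cupC_ofRat] at h0
  exact PadZero.ofRat_injective (h0.trans (map_zero _).symm)

set_option smartUnfolding false in
/-- **N2 FAILS in `U.conjTwist D`** whenever `H³` is twisted and `U` satisfies N1, N2, N4 and has a CM product with
`H³ ≠ 0`: by N1 the monomials `a₀ ∪ a₁ ∪ a₂ = (a₀ ∪ a₁) ∪ a₂ ∈ H² ∪ H¹` span `H³`, and they all vanish. -/
theorem not_fact_cup_hodge (hD3 : degTwist D 3 = true) (h1 : U.Fact_cupExterior) (h2 : U.Fact_cup_hodge)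
    (h4 : U.Fact_hodge_F0) (h3 : ∃ (F : CMField) (n : ℕ) (Θ : Fin (n + 1) → CMType F), Nontrivial (U.Coh (U.cmProd F Θ) 3)) :
    ¬ (U.conjTwist D).Fact_cup_hodge := by
  intro h
  obtain ⟨F, n, Θ, hN⟩ := h3
  haveI : Nontrivial (U.Coh (U.cmProd F Θ) (2 + 1)) := hN
  have htop := span_cupPow_eq_top (h1 F n Θ 2)
  have hbot : Submodule.span ℚ (Set.range (U.cupPow (U.cmProd F Θ) 2)) = ⊥ := by
    rw [Submodule.span_eq_bot]
    rintro _ ⟨a, rfl⟩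
    rw [cupPow_succ]
    exact cup_two_one_eq_zero hD3 h2 h4 h _ _ _
  obtain ⟨v, hv⟩ := exists_ne (0 : U.Coh (U.cmProd F Θ) (2 + 1))
  have hmem : v ∈ Submodule.span ℚ (Set.range (U.cupPow (U.cmProd F Θ) 2)) := by
    rw [htop]
    exact Submodule.mem_top
  rw [hbot] at hmem
  exact hv ((Submodule.mem_bot ℚ).mp hmem)

/-! ### M30 fails too: N2 is a necessary hypothesis of `weightHodge_of_facts` -/

set_option smartUnfolding false in
/-- **M30 `Fact_weightHodge` FAILS in `U.conjTwist D`** whenever `H³` is twisted and `U` satisfies M29, M30 and has a CM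
product with `H³ ≠ 0`: the weight space of `S` in `H³` lies in `H^{p_S,q_S}` (M30 for `U`) and in `conj-H^{p_S,q_S} =
H^{q_S,p_S}` (M30 for the twist), which meet in `0` (`p_S ≠ q_S` as `p_S + q_S = 3` is odd); but the weight spaces span
`H³_ℂ ≠ 0` (M29). -/
theorem not_fact_weightHodge (hD3 : degTwist D 3 = true) (h29 : U.Fact_weightSpan) (h30 : U.Fact_weightHodge)
    (h3 : ∃ (F : CMField) (n : ℕ) (Θ : Fin (n + 1) → CMType F), Nontrivial (U.Coh (U.cmProd F Θ) 3)) :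
    ¬ (U.conjTwist D).Fact_weightHodge := by
  intro h
  obtain ⟨F, n, Θ, hN⟩ := h3
  have hS : ∀ S : Fin (n + 1) → Finset ((F : Type) →+* ℂ), U.weightSpace F Θ S 3 = ⊥ := by
    intro S
    have a := h30 F n Θ 3 S
    have b := h F n Θ 3 S
    change U.weightSpace F Θ S 3 ≤ (U.twistHodge D (U.cmProd F Θ) 3).piece _ _ at b
    rw [twistHodge_of_true hD3, ConjTwist.conjHodge_piece] at b
    by_cases hpq : (∑ j, ∑ s ∈ S j, ind (Θ j) s) + (∑ j, ∑ s ∈ S j, (1 - ind (Θ j) s)) = ((3 : ℕ) : ℤ)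
    · have hne : (∑ j, ∑ s ∈ S j, ind (Θ j) s) ≠ (∑ j, ∑ s ∈ S j, (1 - ind (Θ j) s)) := by
        intro he
        rw [he] at hpq
        omega
      rw [eq_bot_iff, ← ConjTwist.piece_inf_piece_swap_eq_bot (U.hodge (U.cmProd F Θ) 3) hne]
      exact le_inf a b
    · rw [HodgeStructure.piece_eq_bot_of_add_ne _ hpq] at a
      exact le_bot_iff.mp a
  have htop := h29 F n Θ 3
  simp only [hS, iSup_bot] at htop
  obtain ⟨v, hv⟩ := exists_ne (0 : U.Coh (U.cmProd F Θ) 3)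
  have hmem : (ofRat v : U.CohC (U.cmProd F Θ) 3) ∈ (⊥ : Submodule ℂ (U.CohC (U.cmProd F Θ) 3)) := by
    rw [htop]
    exact Submodule.mem_top
  exact hv (PadZero.ofRat_injective (((Submodule.mem_bot ℂ).mp hmem).trans (map_zero _).symm))

end ConjTwist

end Universe

end HodgeCM

end
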